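import Summits.Ventures.QEC.CircuitDistance.ETowerData345X
import Summits.Ventures.QEC.CircuitDistance.ETowerBinder
import Summits.Ventures.QEC.CircuitDistance.SchedK2InstBB144o345X
import Summits.Ventures.QEC.CircuitDistance.PortXSector
import HarnessLib

/-!
# #345 E-fold tower (`[[144,12,12]]` under CNOT order #345, W = 10), sector X: the S7 BRIDGE DATA — index translation versus support
# translation (decided here), and the anchored top classes `TOPS` versus a leaf-entry list (a Bool certificate checker, generic in the list;
# the instance for eng-1's `o345XLeaves` is decided in the value-side file once that aggregator is in the tree)
# (cell `qec`, experiment CDX; seat qec-cdx-type-2 g1; the #345 twin of type-1's `ETowerTopsX`, STEP2-ASSEMBLY-SPEC §B11)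

`idx345OK` / `hidx345`: the two generator identities `inst345X.G (transIdx 12 6 g n) = trQ g (inst345X.G n)` (`idxTrCheck`, kernel) and all
translations (`idxTr_all_of_gens`).  `topsCheck345 LX wit`: entry `i` of the landed `TOPS` (246 anchored classes, `ETowerData345X`), read as a
set of class supports through `inst345X.G`, is the stated translate (`wit[i] = (entry, da, db)`) of the stated entry's word of `LX`;
`hTOPS_of_topsCheck345`: unpacked, the `hTOPS` hypothesis of `ETowerBinder.binder_of_kc` for the word list `LX.map (·.word)`.
No `native_decide`; nothing here asserts a value of `d_circ`.
-/

set_option maxRecDepth 100000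
set_option exponentiation.threshold 1024

namespace Summit.Ventures.QEC.CircuitDistance.ETower.Sec345X

open Literature.InformationTheory.QuantumCodes Summit.Ventures.QEC.Census Summit.Ventures.QEC.Census.Fold
  Summit.Ventures.QEC.CircuitDistance.ETower K2

/-! ## Index translation = support translation -/

/-- KERNEL: index translation by the two torus generators = support translation, for the #345 X instance. -/
theorem idx345OK : idxTrCheck 5 inst345X.G = true := by decide +kernel

/-- **`hidx`** of `binder_of_kc` for the #345 X instance (all translations). -/
theorem hidx345 : ∀ da db n, n < 5 * (12 * 6) →
    inst345X.G (transIdx 12 6 da db n) = trQ (Fin.ofNat 12 da, Fin.ofNat 6 db) (inst345X.G n) :=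
  idxTr_all_of_gens (by decide) (by decide) inst345X.G (idxTr_of_check idx345OK).1 (idxTr_of_check idx345OK).2

/-! ## `TOPS` versus a leaf-entry list: certificate checker -/

/-- Bool CERTIFICATE CHECK: for every `i`, `TOPS[i]` (as supports through `inst345X.G`) is the translate by `(wit[i].2.1, wit[i].2.2)` of
the word of entry `wit[i].1` of `LX`. -/
def topsCheck345 (LX : List (LeafEntry 12 6)) (wit : List (ℕ × ℕ × ℕ)) : Bool :=
  (List.range TOPS.length).all fun i =>
    decide ((wit.getD i (0, 0, 0)).1 < LX.length) &&
    decide (((bitsOf 360 0 (TOPS.getD i 0)).map inst345X.G).toFinset =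
      (((LX.map (·.word)).getD (wit.getD i (0, 0, 0)).1 []).map
        (trQ (Fin.ofNat 12 (wit.getD i (0, 0, 0)).2.1, Fin.ofNat 6 (wit.getD i (0, 0, 0)).2.2))).toFinset)

/-- **`hTOPS`** of `binder_of_kc` for the #345 X instance, from a passing certificate: the anchored top classes are translates of
listed words. -/
theorem hTOPS_of_topsCheck345 {LX : List (LeafEntry 12 6)} {wit : List (ℕ × ℕ × ℕ)} (h : topsCheck345 LX wit = true) :
    ∀ r ∈ TOPS, ∃ wd ∈ LX.map (·.word), ∃ t : BB.Mono 12 6,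
      ((bitsOf (5 * (12 * 6)) 0 r).map inst345X.G).toFinset = (wd.map (trQ t)).toFinset := by
  unfold topsCheck345 at h
  rw [List.all_eq_true] at h
  intro r hr
  obtain ⟨i, hi, rfl⟩ := List.getElem_of_mem hr
  have := h i (List.mem_range.2 hi)
  rw [Bool.and_eq_true, decide_eq_true_eq, decide_eq_true_eq, List.getD_eq_getElem _ _ hi] at this
  obtain ⟨hw, ht⟩ := this
  have hw' : (wit.getD i (0, 0, 0)).1 < (LX.map (·.word)).length := by rw [List.length_map]; exact hw
  refine ⟨_, ?_, _, ht⟩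
  rw [List.getD_eq_getElem _ _ hw']; exact List.getElem_mem hw'

end Summit.Ventures.QEC.CircuitDistance.ETower.Sec345X
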